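import Mathlib
import Summits.CriticalPhenomena.PercolationContinuityZ3.Theorems.PercAxialLogConvexityAxialLogConvexStubBoxTransport
import Summits.CriticalPhenomena.PercolationContinuityZ3.Theorems.PercAxialLogConvexityAxialLogConvexStubLowerOfTransport
import Summits.CriticalPhenomena.PercolationContinuityZ3.Theorems.PercAxialLogConvexityAxialLogConvexStubUpperLimitZ3
import Summits.CriticalPhenomena.PercolationContinuityZ3.Theorems.PercAxialLogConvexityAxialLogConvexStubUpperOfTransport
import HarnessLib

/-!
# Crux `AxialLogConvex` (stmt-CriticalPhenomena-11549), line `registered` — the torus-tube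
approximation of the axial two-point function of `ℤ³` (all four provable stubs assembled)

For bond percolation with ANY parameter `p ∈ [0,1]`, the axial two-point function of the torus
tube `T_k = ℤ × (ℤ/kℤ)² = zdGraph 1 □ torusGraph 2 k` converges to that of `ℤ³` as the width
`k → ∞`:
`P_p^{T_k}((0,0) ↔ ((n),0)) → τ_p(0, n e₁)`.
This is the bond-percolation, two-point analogue of König–Richthammer, arXiv:2207.13173,
Prop. 1(b) (there: `(C_{2k+1}^{d-1})^× → ℤ^d`), proved the same way: a two-sided local
approximation through the box `B(m)` (transport of the product measure along the local
isomorphism `x ↦ ((x 0), Torus.proj k (Fin.tail x))`, `stub_boxTransport`), the lower side by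
`{0 ↔ n e₁ in B(m)} ↑ {0 ↔ n e₁}` (`stub_lowerOfTransport`), the upper side by Grimmett's
`τ*`-event `{0 ↔ x in B(m)} ∪ {0 ↔ ∂B(m), x ↔ ∂B(m) in B(m)}`, whose probability decreases to
`τ_p(0,x)` by a.s. uniqueness of the infinite cluster (Grimmett 1999 (8.11)–(8.13), Thm (8.1);
`stub_upperLimitZ3`, `stub_upperOfTransport`). It is the `k → ∞` half of the line `registered`
(torus-tube transfer) for the crux `AxialLogConvex`; the other half, log-convexity on the tubes,
is the open stub `stub_torusTubeLCX`.

* `torusTube_axial_lower` / `torusTube_axial_upper` — the two eventual bounds, hypotheses-free;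
* `tendsto_torusTube_axial` — `a_k(p,n) → τ_p(0, n e₁)` for every `p`, `n`.
-/

noncomputable section

namespace Summit.CriticalPhenomena.PercolationContinuityZ3.Theorems.AxialLogConvex

open Filter Topology MeasureTheory

/-- **Lower tube approximation** (all stubs discharged): for every `p`, `n`, `ε > 0`, eventually in
the width `k`, `τ_p(0, n e₁) − ε ≤ P_p^{T_k}(0 ↔ (n),0)`. [folklore; KonigRichthammer2025 Prop. 1(b)] -/
theorem torusTube_axial_lower (p : unitInterval) (n : ℕ) (ε : ℝ) (hε : 0 < ε) :
    ∀ᶠ k : ℕ in atTop, Literature.Probability.Percolation.tau 3 p 0 (Pi.single 0 (n : ℤ)) - ε ≤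
      (Literature.Probability.Percolation.bondPercolation
        ((Literature.Probability.LatticeModels.zdGraph 1).boxProd
          (Literature.Probability.LatticeModels.torusGraph 2 k)) p).real
        (Literature.Probability.Percolation.openConn
          (0 : Literature.Probability.LatticeModels.Site 1 × Literature.Probability.LatticeModels.TorusSite 2 k)
          ((fun _ => (n : ℤ)), 0)) :=
  stub_lowerOfTransport stub_boxTransport p n ε hε

/-- **Upper tube approximation** (all stubs discharged): for every `p`, `n`, `ε > 0`, eventually in
the width `k`, `P_p^{T_k}(0 ↔ (n),0) ≤ τ_p(0, n e₁) + ε`. Valid at every `p` (uniqueness of the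
infinite cluster replaces `θ(p) = 0`). [folklore; KonigRichthammer2025 Prop. 1(b); GrimmettPercolation1999 (8.11)–(8.13)] -/
theorem torusTube_axial_upper (p : unitInterval) (n : ℕ) (ε : ℝ) (hε : 0 < ε) :
    ∀ᶠ k : ℕ in atTop,
      (Literature.Probability.Percolation.bondPercolation
        ((Literature.Probability.LatticeModels.zdGraph 1).boxProd
          (Literature.Probability.LatticeModels.torusGraph 2 k)) p).real
        (Literature.Probability.Percolation.openConn
          (0 : Literature.Probability.LatticeModels.Site 1 × Literature.Probability.LatticeModels.TorusSite 2 k)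
          ((fun _ => (n : ℤ)), 0)) ≤
      Literature.Probability.Percolation.tau 3 p 0 (Pi.single 0 (n : ℤ)) + ε :=
  stub_upperOfTransport stub_boxTransport stub_upperLimitZ3 p n ε hε

/-- **The torus tubes exhaust `ℤ³` for the axial two-point function**: for every `p ∈ [0,1]` and
`n`, `P_p^{T_k}((0,0) ↔ ((n),0)) → τ_p(0, n e₁)` as `k → ∞` (bond-percolation two-point analogue
of König–Richthammer 2025, Prop. 1(b)). [folklore; KonigRichthammer2025 Prop. 1(b)] -/
theorem tendsto_torusTube_axial :
    ∀ (p : unitInterval) (n : ℕ), Filter.Tendsto (fun k : ℕ => (Literature.Probability.Percolation.bondPercolation ((Literature.Probability.LatticeModels.zdGraph 1).boxProd (Literature.Probability.LatticeModels.torusGraph 2 k)) p).real (Literature.Probability.Percolation.openConn (0 : Literature.Probability.LatticeModels.Site 1 × Literature.Probability.LatticeModels.TorusSite 2 k) ((fun _ => (n : ℤ)), 0))) Filter.atTop (nhds (Literature.Probability.Percolation.tau 3 p 0 (Pi.single 0 (n : ℤ)))) := by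
  intro p n
  rw [Metric.tendsto_atTop]
  intro ε hε
  have h := (torusTube_axial_lower p n (ε / 2) (by positivity)).and
    (torusTube_axial_upper p n (ε / 2) (by positivity))
  obtain ⟨N, hN⟩ := eventually_atTop.1 h
  refine ⟨N, fun k hk => ?_⟩
  obtain ⟨h1, h2⟩ := hN k hk
  rw [Real.dist_eq, abs_lt]
  constructor <;> linarith

end Summit.CriticalPhenomena.PercolationContinuityZ3.Theorems.AxialLogConvex

end
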